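import Literature.NumberTheory.DiophantineGeometry.TerjanianEvenExponent
import HarnessLib

/-!
# Terjanian's Jacobi-symbol law for `U_n = (r^n − s^n)/(r − s)`: `(U_m / U_n) = (m / n)`

Topic `Literature/NumberTheory/DiophantineGeometry`. Sources: G. Terjanian, C. R. Acad. Sci. Paris 285 (1977) 973–975
[Terjanian1977]; the law as printed in A. Granville, *Primitive prime factors in second-order linear recurrence
sequences*, Acta Arith. 155 (2012) 431–452 [Granville2012], §1c eq. (2), verbatim: "Terjanian's key observation is
that the Jacobi symbols `(x_m / x_n) = (m / n)` for all odd, positive integers `m` and `n`" (there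
`x_n = (r^n − s^n)/(r − s)` with `r ≡ s ≡ 1 (mod 4)`; Rotkiewicz's form quoted loc. cit.: "`b` even and
`c ≡ −1 (mod 4)`", i.e. `r, s` odd with `rs ≡ 1 (mod 4)`).

DEDUPLICATION NOTE (2026-08-25, same seat, same day as the first version): this law was ALREADY in the tree as
`Terjanian.jacobi_Q` in `TerjanianEvenExponent.lean` ([Ribenboim1999FLTAmateurs, Ch. VI (4J)(2)], with
`Terjanian.Q n a b = Σ_{k<n} a^k b^{n−1−k}`, definitionally the sum below); the first version of this file (399 lines)
re-proved it from scratch, having missed that file in its search. The public statement `terjanian_jacobiSym_geom_sum₂`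
is kept byte-for-byte (it is cited on the venture cell's bus and in its notes) and is now a one-line corollary of
`Terjanian.jacobi_Q`; nothing else of the first version was public. Literature seat of the venture cell `pub-abcsig`
(lit g14), 2026-08-25.
-/

namespace Literature.NumberTheory.DiophantineGeometry

open Finset

section Lucas

variable {r s : ℤ}

/-- **Terjanian's Jacobi-symbol law** ([Granville2012, §1c, eq. (2)]: "Terjanian's key observation is that the Jacobi
symbols `(x_m / x_n) = (m / n)` for all odd, positive integers `m` and `n`"; there `x_n = (r^n − s^n)/(r − s)` with
`r ≡ s ≡ 1 (mod 4)`, and in Rotkiewicz's form quoted loc. cit. "`b` even and `c ≡ −1 (mod 4)`", i.e. `r, s` odd with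
`rs ≡ 1 (mod 4)`): for coprime odd integers `r ≠ s` with `r ≡ s (mod 4)` and coprime odd `m, n ≥ 1`,
`(U_m / U_n) = (m / n)` where `U_n = Σ_{i<n} r^i s^{n−1−i} > 0`. (Coprimality of `m, n` is assumed here; both
sides vanish otherwise.) This is `Terjanian.jacobi_Q` of `TerjanianEvenExponent.lean` in `geom_sum₂` vocabulary (the
hypothesis `hr` is implied by `hs` and `h4` and kept only for the statement's stability).
[cite: Granville2012, §1c eq. (2) (Terjanian 1977 / Rotkiewicz); Ribenboim1999FLTAmateurs, Ch. VI (4J)(2)] -/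
theorem terjanian_jacobiSym_geom_sum₂ (h4 : (4 : ℤ) ∣ r - s) (hr : Odd r) (hs : Odd s) (hne : r ≠ s)
    (hcop : IsCoprime r s) {m n : ℕ} (hm : Odd m) (hn : Odd n) (hmn : Nat.Coprime m n) :
    jacobiSym (∑ i ∈ range m, r ^ i * s ^ (m - 1 - i)) (∑ i ∈ range n, r ^ i * s ^ (n - 1 - i)).natAbs =
      jacobiSym (m : ℤ) n := by
  have _ : Odd r := hr
  exact Terjanian.jacobi_Q hs h4 hne hcop hm hn hmn

end Lucas

end Literature.NumberTheory.DiophantineGeometry
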